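import Summits.QuantumFields.YangMills.Theorems.BalabanUVNodesN27AtRecord11
import Summits.QuantumFields.YangMills.Theorems.BalabanUVNodesSpineCarriersOfRecord13
import Summits.QuantumFields.YangMills.Theorems.BalabanUVNodesRateCarriersOfRecord13

/-!
# BalabanUVNodes ∕ N27 = binder B5 AT THE RECORD, XXXVIII — N27 AT THE STAGE-13 CARRIER HOMES OF RECORD: B5 `Spine ₁₃C` from the one-application stub instances at
# (T-SPINE)₁₃ `YMDAG.UVSplit.SRec₁₃ cr` (dag-n20-d, `…SpineCarriersOfRecord13` p490271) and (T-RATE)₁₃ `YMDAG.UVSplit.RRec₁₃ 𝔯` (dag-n22-e 1″, `…RateCarriersOfRecord13` p493463,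
# keyed by RR-2's canonical datum key `Node00.IsDatumOfRecord₁₃C` ∕ `.params`, `Node00/Record13DatumKey` p489352) and the N19′ edge AT THE HOMES' OWN KEYS — the K4 existence stub
# `S_R00x` DISCHARGED BY NAME (`s_R00x_rRec₁₃`): the ₁₃ twin of module XXVII §§1–2 (its §3 face is module XXXVI `keyedGuarded₁₃_of_spine_rec13C`)
# (cell `pub-ymgap`, HUMAN RULING D-0062 Track A, R134 seat `pub-ymgap-dag-n27-c` (s2) gen 6; `--supports stmt-QuantumFields-19912 --as helper` — K3‴ `SpineGivenEndpointR13`, dag-lead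
# KEY TABLE WORDS-133∕134∕135 («n27 composer — import line only; names are EXACTLY the sed twins»); COUNT-NEUTRAL; `N`-generic, NO Theses import — the route-facing `N = 2` line is
# module XXXVII's `spineGivenEndpointR13_of_homes₁₃` (append-only, once this module is on the olean))

THE KNIT.  XIV `spine_of_rateStubs_coreEdge` at `Rec := Node00.IsRecordOfRecord₁₃C F N`, `SRec := SRec₁₃ cr`, `RRec := RRec₁₃ 𝔯`:
* `S_R00x ₁₃C (RRec₁₃ 𝔯)` — PROVED at the home (`YMDAG.UVSplit.s_R00x_rRec₁₃`: the run-length-0 bundle at the record's own datum key; existence of residual objects is free),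
  so it is NOT a hypothesis here;
* `S_N14`–`S_N18`, `S_N22` at `RRec₁₃ 𝔯` — the home's one-application instances (`s_N14_rRec₁₃_iff` … `s_N22_rRec₁₃_iff`), HYPOTHESES;
* `S_N27x ₁₃C (SRec₁₃ cr)`, `S_N20`, `S_N21` at `SRec₁₃ cr` — the home's instances (`s_N27x_sRec₁₃_of`, `s_N20_sRec₁₃_iff`, `s_N21_sRec₁₃_iff`), HYPOTHESES;
* the N19′ ∃δ-edge AT THE TWO HOMES' KEYS (`h19`): for every admissible Stage-13 `θ` with provisos, every `g₀`, `os`, every datum key `h : IsDatumOfRecord₁₃C F N (datumOfRecord₁₃ F N θ hP)`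
  of θ's own datum and every run length `k`: the six rates at the CANONICAL rate bundle `rateCarriersOfRecord₁₃ 𝔯 F h.params h.provisos g₀ os k` give SOME summable `δ` carrying
  `Spine.NE7.Core` on the shell-free cores of `cr F θ hP g₀ os` (`coreEdge_of_homes₁₃`).

WHAT IS KERNEL-CHECKED ([bookkeeping]; 0 `def`, 0 `sorry`): `coreEdge_of_homes₁₃` · **`spine_rec13C_of_homes₁₃`** (the knit above ⇒ `Spine ₁₃C`) · `spine_rec13C_of_homes₁₃_faces` (the same with
the spine-side stubs replaced by their θ-indexed readings through the home's faces: N20 `RelWeightBound` ∕ N21 `ShellWeightBound` at `cr F θ hP g₀ os`, N27x's unconditional θ-form).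

HONEST FRAMING.  COMPOSITE-node bookkeeping: every K4∕K5 stub and the edge are HYPOTHESES with NO producer at the Stage-13 record today (0∕1; the children's ₁₃ re-keying is in
progress); the readings `cr`, `𝔯` are PARAMETERS of the homes (no reading of Bałaban's dressed expansion ∕ dressed tower of record exists); `S_R00x` is discharged only because residual
objects exist by construction (located, not content); nothing of Bałaban's asserted; NE7 ∕ NE7b ∕ NE7c NOT PRINTED for d = 4 and NOT PROVED; NO node discharged; K3‴ NOT claimed; no ₁₃
inhabitant claimed (K0‴ open); counts UNMOVED (typed 28∕28 · discharged 5∕27, A 5∕28); one finite four-torus programme at fixed `ε` — NOT ℝ⁴, NOT infinite volume, NOT OS, NOT a mass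
gap, NOT Clay.  No decl below carries a cite tag.
-/

namespace Summit.QuantumFields.YangMills.Theorems.BalabanUVNodesN27SpineRecord

open Literature.MathematicalPhysics.QuantumFieldTheory.Balaban1983to89
open Literature.MathematicalPhysics.QuantumFieldTheory.Balaban1983to89.T4Continuum
open T4WeightBudget (RelWeightBound)
open T4IndicatorShell (ShellWeightBound)
open T4ContinuumYM4Torus (ForSmallCouplings)
open Summit.QuantumFields.BalabanUV.T4Continuum.Spine
open YMDAG.UVSplit
open Node00 (Stage13Params datumOfRecord₁₃ IsRecordOfRecord₁₃C IsDatumOfRecord₁₃C)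

variable {N : ℕ} [NeZero N] (cr : SpineReading₁₃ N) (𝔯 : RateReading₁₃ N)

/-! ## §1 The N19′ edge at the two homes' keys -/

/-- **XIV's N19′ EDGE AT `(SRec₁₃ cr, RRec₁₃ 𝔯)`**: a bundle pinned by `SRec₁₃ cr` is `cr F θ hP g₀ os` for an admissible θ with provisos realising `D`; rate carriers pinned by `RRec₁₃ 𝔯` at
the same `D` are a run length `k` of the canonical bundle at a datum key of `D`; so the edge XIV consumes is the HOME-KEYED pair form `h19`. [bookkeeping] -/
theorem coreEdge_of_homes₁₃
    (h19 : ∀ (F : T4Family) (θ : Stage13Params F N) (hP : θ.Provisos₁₃ F N), θ.Admissible F N → ∀ (g₀ : ℕ → ℝ) (os : List (ULoop F))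
      (h : IsDatumOfRecord₁₃C F N (datumOfRecord₁₃ F N θ hP)) (k : ℕ),
      RatesAt (datumOfRecord₁₃ F N θ hP) (rateCarriersOfRecord₁₃ 𝔯 F h.params h.provisos g₀ os k) → letI := (cr F θ hP g₀ os).dec
        ∃ δ : ℕ → ℝ, NE7.Core (cr F θ hP g₀ os).l₀ (cr F θ hP g₀ os).vol (cr F θ hP g₀ os).T (cr F θ hP g₀ os).Bad
          (fun K t τ => (cr F θ hP g₀ os).A K t τ - (cr F θ hP g₀ os).shA K t τ) (fun K t τ => (cr F θ hP g₀ os).B K t τ - (cr F θ hP g₀ os).shB K t τ) δ ∧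
          Summable δ)
    (F : T4Family) (D : Datum F N) (g₀ : ℕ → ℝ) (os : List (ULoop F)) (S : SpineCarriers) (R : RateCarriers N)
    (hS : SRec₁₃ cr F D g₀ os S) (hR : RRec₁₃ 𝔯 F D g₀ os R) (hrates : RatesAt D R) : letI := S.dec
      ∃ δ : ℕ → ℝ, NE7.Core S.l₀ S.vol S.T S.Bad (fun K t τ => S.A K t τ - S.shA K t τ) (fun K t τ => S.B K t τ - S.shB K t τ) δ ∧ Summable δ := by
  obtain ⟨θ, hP, hθ, rfl, rfl⟩ := hS
  obtain ⟨h, k, rfl⟩ := hR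
  exact h19 F θ hP hθ g₀ os h k hrates

/-! ## §2 The knit at the homes -/

/-- **N27 = B5 AT THE STAGE-13 RECORD FROM THE STUB INSTANCES OF THE TWO CARRIER HOMES OF RECORD AND THE HOME-KEYED N19′ EDGE — `S_R00x` DISCHARGED BY NAME.**  XIV
`spine_of_rateStubs_coreEdge` at `(₁₃C, SRec₁₃ cr, RRec₁₃ 𝔯)` with `hx := s_R00x_rRec₁₃ 𝔯` (home theorem): the six K4 stubs at `RRec₁₃ 𝔯`, the three K5 stubs at `SRec₁₃ cr` and `h19` give
`Spine ₁₃C`.  Every remaining stub a HYPOTHESIS (0∕1 today). [bookkeeping] -/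
theorem spine_rec13C_of_homes₁₃ (h14 : S_N14 (RRec₁₃ 𝔯)) (h15 : S_N15 (RRec₁₃ 𝔯)) (h16 : S_N16 (RRec₁₃ 𝔯)) (h17 : S_N17 (RRec₁₃ 𝔯))
    (h18 : S_N18 (RRec₁₃ 𝔯)) (h22 : S_N22 (RRec₁₃ 𝔯)) (hx' : S_N27x (fun F D w => IsRecordOfRecord₁₃C F N D w) (SRec₁₃ cr)) (h20 : S_N20 (SRec₁₃ cr))
    (h21 : S_N21 (SRec₁₃ cr))
    (h19 : ∀ (F : T4Family) (θ : Stage13Params F N) (hP : θ.Provisos₁₃ F N), θ.Admissible F N → ∀ (g₀ : ℕ → ℝ) (os : List (ULoop F))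
      (h : IsDatumOfRecord₁₃C F N (datumOfRecord₁₃ F N θ hP)) (k : ℕ),
      RatesAt (datumOfRecord₁₃ F N θ hP) (rateCarriersOfRecord₁₃ 𝔯 F h.params h.provisos g₀ os k) → letI := (cr F θ hP g₀ os).dec
        ∃ δ : ℕ → ℝ, NE7.Core (cr F θ hP g₀ os).l₀ (cr F θ hP g₀ os).vol (cr F θ hP g₀ os).T (cr F θ hP g₀ os).Bad
          (fun K t τ => (cr F θ hP g₀ os).A K t τ - (cr F θ hP g₀ os).shA K t τ) (fun K t τ => (cr F θ hP g₀ os).B K t τ - (cr F θ hP g₀ os).shB K t τ) δ ∧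
          Summable δ) :
    Spine (N := N) fun F D w => IsRecordOfRecord₁₃C F N D w :=
  spine_of_rateStubs_coreEdge _ (SRec₁₃ cr) (RRec₁₃ 𝔯) (s_R00x_rRec₁₃ 𝔯) h14 h15 h16 h17 h18 h22 hx' h20 h21 (coreEdge_of_homes₁₃ cr 𝔯 h19)

/-- **THE SAME WITH THE SPINE-SIDE STUBS READ THROUGH THE HOME's FACES**: N20 `RelWeightBound` and N21 `ShellWeightBound` at `cr F θ hP g₀ os` for every admissible Stage-13 θ with
provisos (`s_N20_sRec₁₃_iff` ∕ `s_N21_sRec₁₃_iff`), and N27x's unconditional θ-form (`s_N27x_sRec₁₃_of`: positivity + E1∕E2 against the datum's dressed partition functions at every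
admissible θ); rate stubs as in `spine_rec13C_of_homes₁₃`. [bookkeeping] -/
theorem spine_rec13C_of_homes₁₃_faces (h14 : S_N14 (RRec₁₃ 𝔯)) (h15 : S_N15 (RRec₁₃ 𝔯)) (h16 : S_N16 (RRec₁₃ 𝔯)) (h17 : S_N17 (RRec₁₃ 𝔯))
    (h18 : S_N18 (RRec₁₃ 𝔯)) (h22 : S_N22 (RRec₁₃ 𝔯))
    (hx : ∀ (F : T4Family) (θ : Stage13Params F N) (hP : θ.Provisos₁₃ F N), θ.Admissible F N → ∀ (g₀ : ℕ → ℝ) (os : List (ULoop F)),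
      0 < (cr F θ hP g₀ os).l₀ ∧ 0 < (cr F θ hP g₀ os).vol ∧
        (∀ (K : ℕ) (t : ℝ), |t| ≤ (cr F θ hP g₀ os).l₀ →
          T4GenFunBounds.schemeZ ((datumOfRecord₁₃ F N θ hP).scheme g₀) os ((cr F θ hP g₀ os).K₀ + K) t =
            ∑ τ ∈ (cr F θ hP g₀ os).T K, (cr F θ hP g₀ os).A K t τ) ∧
        (∀ (K : ℕ) (t : ℝ), |t| ≤ (cr F θ hP g₀ os).l₀ →
          T4GenFunBounds.schemeZ ((datumOfRecord₁₃ F N θ hP).scheme g₀) os ((cr F θ hP g₀ os).K₀ + K + 1) t =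
            ∑ τ ∈ (cr F θ hP g₀ os).T K, (cr F θ hP g₀ os).B K t τ))
    (h20 : ∀ (F : T4Family) (θ : Stage13Params F N) (hP : θ.Provisos₁₃ F N), θ.Admissible F N → ∀ (g₀ : ℕ → ℝ) (os : List (ULoop F)),
      RelWeightBound (cr F θ hP g₀ os).l₀ (cr F θ hP g₀ os).T (cr F θ hP g₀ os).A (cr F θ hP g₀ os).B (cr F θ hP g₀ os).Bad (cr F θ hP g₀ os).W)
    (h21 : ∀ (F : T4Family) (θ : Stage13Params F N) (hP : θ.Provisos₁₃ F N), θ.Admissible F N → ∀ (g₀ : ℕ → ℝ) (os : List (ULoop F)),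
      ShellWeightBound (cr F θ hP g₀ os).l₀ (cr F θ hP g₀ os).T (cr F θ hP g₀ os).A (cr F θ hP g₀ os).B (cr F θ hP g₀ os).shA (cr F θ hP g₀ os).shB
        (cr F θ hP g₀ os).Wsh)
    (h19 : ∀ (F : T4Family) (θ : Stage13Params F N) (hP : θ.Provisos₁₃ F N), θ.Admissible F N → ∀ (g₀ : ℕ → ℝ) (os : List (ULoop F))
      (h : IsDatumOfRecord₁₃C F N (datumOfRecord₁₃ F N θ hP)) (k : ℕ),
      RatesAt (datumOfRecord₁₃ F N θ hP) (rateCarriersOfRecord₁₃ 𝔯 F h.params h.provisos g₀ os k) → letI := (cr F θ hP g₀ os).dec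
        ∃ δ : ℕ → ℝ, NE7.Core (cr F θ hP g₀ os).l₀ (cr F θ hP g₀ os).vol (cr F θ hP g₀ os).T (cr F θ hP g₀ os).Bad
          (fun K t τ => (cr F θ hP g₀ os).A K t τ - (cr F θ hP g₀ os).shA K t τ) (fun K t τ => (cr F θ hP g₀ os).B K t τ - (cr F θ hP g₀ os).shB K t τ) δ ∧
          Summable δ) :
    Spine (N := N) fun F D w => IsRecordOfRecord₁₃C F N D w :=
  spine_rec13C_of_homes₁₃ cr 𝔯 h14 h15 h16 h17 h18 h22 (s_N27x_sRec₁₃_of cr hx) ((s_N20_sRec₁₃_iff cr).mpr h20) ((s_N21_sRec₁₃_iff cr).mpr h21) h19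

end Summit.QuantumFields.YangMills.Theorems.BalabanUVNodesN27SpineRecord
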